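import Literature.Analysis.FluidPDE.ParabolicHeatPotentials
import HarnessLib

/-!
# Jia–Šverák 2014, proof of Thm. 3.2: extension of the Hölder representative to the final time

Analysis/FluidPDE proofs file (theorems only, no new definitions, no new named facts), part of
the proof of the named fact `Literature.Analysis.FluidPDE.jia_sverak_2014_theorem_3_2`
(`JiaSverak2014LocalRegularity.lean`; H. Jia, V. Šverák, Invent. Math. 196 (2014) =
arXiv:1204.0529, §3 Thm. 3.2). The representative of `JiaSverak2014HolderRepresentative.lean` is
produced on `[0, T_b] × B̄(x₀, 1/4)` for every `T_b` *strictly* below the final time `T₀` of the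
slab (a time cut-off is needed), with a constant independent of `T_b`; the fact is stated on the
closed interval `[0, min(T, T')]`. This file performs the elementary passage to the limit
`T_b ↑ T₀`: uniformly Hölderian representatives on the boxes `[0, T_n] × B̄`, `T_n ↑ T₀`, which agree
a.e. with `u`, agree with each other on the common boxes (continuity), and their values converge
as `n → ∞` (uniform Hölder continuity in time) to a representative on `[0, T₀] × B̄` with the same
constant (`exists_holder_rep_of_forall_lt`).

## References

* H. Jia, V. Šverák, Invent. Math. 196 (2014) = arXiv:1204.0529, §3, Thm. 3.2. Bib key
  `JiaSverak2014`.
-/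

noncomputable section

open MeasureTheory TopologicalSpace Set Function Filter Metric
open _root_.Topology
open scoped ENNReal NNReal

namespace Literature.Analysis.FluidPDE

namespace JiaSverak2014

/-! ### Continuity and rigidity of parabolic-Hölder functions -/

/-- A parabolic-Hölder function (`0 < γ`) is continuous on its set. [folklore] -/
theorem continuousOn_of_isParabolicHolderOn {S : Set (ℝ × EuclideanSpace ℝ (Fin 3))}
    {h : ℝ × (EuclideanSpace ℝ (Fin 3)) → (EuclideanSpace ℝ (Fin 3))} {C γ : ℝ} (hγ : 0 < γ)
    (hh : IsParabolicHolderOn S h C γ) : ContinuousOn h S := by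
  rw [Metric.continuousOn_iff]
  intro z hz ε hε
  set C' : ℝ := max C 0 + 1 with hC'
  have hC'0 : 0 < C' := by have := le_max_right C 0; rw [hC']; linarith
  -- choose `η` with `C' η^γ < ε`
  obtain ⟨η, hη, hηε⟩ : ∃ η : ℝ, 0 < η ∧ C' * η ^ γ < ε := by
    refine ⟨(ε / (2 * C')) ^ (1 / γ), by positivity, ?_⟩
    rw [← Real.rpow_mul (by positivity), one_div_mul_cancel hγ.ne', Real.rpow_one]
    have : C' * (ε / (2 * C')) = ε / 2 := by field_simp
    rw [this]; linarith
  refine ⟨min (η ^ 2 / 4) (η / 2), by positivity, fun z' hz' hd => ?_⟩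
  have h1 := hh z' hz' z hz
  have hdt : |z'.1 - z.1| < η ^ 2 / 4 := by
    have h : dist z'.1 z.1 ≤ dist z' z := by rw [Prod.dist_eq]; exact le_max_left _ _
    rw [Real.dist_eq] at h
    exact (h.trans_lt hd).trans_le (min_le_left _ _)
  have hdx : ‖z'.2 - z.2‖ < η / 2 := by
    have h : dist z'.2 z.2 ≤ dist z' z := by rw [Prod.dist_eq]; exact le_max_right _ _
    rw [dist_eq_norm] at h
    exact (h.trans_lt hd).trans_le (min_le_right _ _)
  have hsq : |z'.1 - z.1| ^ (1 / 2 : ℝ) < η / 2 := by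
    have h0 : 0 ≤ |z'.1 - z.1| := abs_nonneg _
    calc |z'.1 - z.1| ^ (1 / 2 : ℝ) < (η ^ 2 / 4) ^ (1 / 2 : ℝ) := Real.rpow_lt_rpow h0 hdt (by norm_num)
      _ = η / 2 := by
          rw [show η ^ 2 / 4 = (η / 2) ^ 2 by ring, ← Real.sqrt_eq_rpow, Real.sqrt_sq (by positivity)]
  have hsum : |z'.1 - z.1| ^ (1 / 2 : ℝ) + ‖z'.2 - z.2‖ < η := by linarith
  have hsum0 : 0 ≤ |z'.1 - z.1| ^ (1 / 2 : ℝ) + ‖z'.2 - z.2‖ := by positivity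
  rw [dist_eq_norm]
  calc ‖h z' - h z‖ ≤ C * (|z'.1 - z.1| ^ (1 / 2 : ℝ) + ‖z'.2 - z.2‖) ^ γ := h1
    _ ≤ C' * (|z'.1 - z.1| ^ (1 / 2 : ℝ) + ‖z'.2 - z.2‖) ^ γ := by
        refine mul_le_mul_of_nonneg_right ?_ (Real.rpow_nonneg hsum0 _)
        have := le_max_left C 0; rw [hC']; linarith
    _ ≤ C' * η ^ γ := mul_le_mul_of_nonneg_left (Real.rpow_le_rpow hsum0 hsum.le hγ.le) hC'0.le
    _ < ε := hηε

/-- Two functions continuous on an open set and a.e. equal there are equal there (Lebesgue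
measure charges open sets). [folklore] -/
theorem eqOn_of_ae_eq_of_continuousOn' {O : Set (ℝ × EuclideanSpace ℝ (Fin 3))} (hO : IsOpen O)
    {f g : ℝ × (EuclideanSpace ℝ (Fin 3)) → (EuclideanSpace ℝ (Fin 3))} (hf : ContinuousOn f O) (hg : ContinuousOn g O)
    (hae : f =ᵐ[volume.restrict O] g) : EqOn f g O := by
  intro w hw
  by_contra hne
  have hpos : 0 < ‖f w - g w‖ := norm_pos_iff.2 (sub_ne_zero.2 hne)
  have hc : ContinuousOn (fun z => ‖f z - g z‖) O := (hf.sub hg).norm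
  set N : Set (ℝ × EuclideanSpace ℝ (Fin 3)) := O ∩ (fun z => ‖f z - g z‖) ⁻¹' Ioi (‖f w - g w‖ / 2) with hN
  have hNopen : IsOpen N := hc.isOpen_inter_preimage hO isOpen_Ioi
  have hwN : w ∈ N := ⟨hw, by simp only [mem_preimage, mem_Ioi]; linarith⟩
  have hNpos : 0 < volume N := hNopen.measure_pos volume ⟨w, hwN⟩
  have hNzero : volume N = 0 := by
    have h1 : ∀ᵐ z ∂(volume : Measure (ℝ × EuclideanSpace ℝ (Fin 3))), z ∈ O → f z = g z :=
      (ae_restrict_iff' hO.measurableSet).1 hae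
    have h0 := ae_iff.1 h1
    refine measure_mono_null (fun z hzN => ?_) h0
    intro hz
    have := hz hzN.1
    have h2 : ‖f w - g w‖ / 2 < ‖f z - g z‖ := hzN.2
    rw [this, sub_self, norm_zero] at h2
    linarith
  exact hNpos.ne' hNzero

/-- **Rigidity on the closed box**: two functions parabolic-Hölderian on `[0,T] × B̄(x₀, r)` and a.e.
equal on `(0,T) × B(x₀, r)` agree on the closed box (`0 < T`, `0 < r`, `0 < γ`). [folklore] -/
theorem eqOn_box_of_ae_eq_of_holder {T r C γ : ℝ} (hT : 0 < T) (hr : 0 < r) (hγ : 0 < γ)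
    {x₀ : EuclideanSpace ℝ (Fin 3)} {f g : ℝ × (EuclideanSpace ℝ (Fin 3)) → (EuclideanSpace ℝ (Fin 3))}
    (hf : IsParabolicHolderOn (Icc 0 T ×ˢ closedBall x₀ r) f C γ)
    (hg : IsParabolicHolderOn (Icc 0 T ×ˢ closedBall x₀ r) g C γ)
    (hae : f =ᵐ[volume.restrict (Ioo 0 T ×ˢ ball x₀ r)] g) :
    EqOn f g (Icc 0 T ×ˢ closedBall x₀ r) := by
  set K : Set (ℝ × EuclideanSpace ℝ (Fin 3)) := Icc 0 T ×ˢ closedBall x₀ r with hK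
  set O : Set (ℝ × EuclideanSpace ℝ (Fin 3)) := Ioo 0 T ×ˢ ball x₀ r with hO
  have hOo : IsOpen O := isOpen_Ioo.prod isOpen_ball
  have hOK : O ⊆ K := Set.prod_mono Ioo_subset_Icc_self ball_subset_closedBall
  have hfc := continuousOn_of_isParabolicHolderOn hγ hf
  have hgc := continuousOn_of_isParabolicHolderOn hγ hg
  have hO_eq : EqOn f g O := eqOn_of_ae_eq_of_continuousOn' hOo (hfc.mono hOK) (hgc.mono hOK) hae
  -- approximate a point of `K` by points of `O`
  rintro ⟨t, x⟩ ⟨ht, hx⟩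
  rw [mem_Icc] at ht
  rw [mem_closedBall, dist_eq_norm] at hx
  set w : ℕ → ℝ := fun n => 1 - 1 / ((n : ℝ) + 2) with hw
  have hw0 : ∀ n, 0 < w n := fun n => by
    simp only [hw]; have : (1 : ℝ) / ((n : ℝ) + 2) < 1 := by rw [div_lt_one (by positivity)]; linarith
    linarith
  have hw1 : ∀ n, w n < 1 := fun n => by
    simp only [hw]; have : (0 : ℝ) < 1 / ((n : ℝ) + 2) := by positivity
    linarith
  have hwlim : Tendsto w atTop (𝓝 1) := by
    have h : Tendsto (fun n : ℕ => (1 : ℝ) / ((n : ℝ) + 2)) atTop (𝓝 0) := tendsto_one_div_add_atTop_nhds_zero_nat.comp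
      (tendsto_add_atTop_nat 1) |>.congr (fun n => by simp only [Function.comp, Nat.cast_add, Nat.cast_one]; ring_nf)
    have := h.const_sub 1
    simpa only [sub_zero] using this
  set zs : ℕ → ℝ × EuclideanSpace ℝ (Fin 3) := fun n =>
    ((1 - w n) * (T / 2) + w n * t, x₀ + w n • (x - x₀)) with hzs
  have hzsO : ∀ n, zs n ∈ O := fun n => by
    refine ⟨⟨?_, ?_⟩, ?_⟩
    · simp only [hzs]; nlinarith [hw0 n, hw1 n, ht.1]
    · simp only [hzs]; nlinarith [hw0 n, hw1 n, ht.2]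
    · simp only [hzs, mem_ball, dist_eq_norm, add_sub_cancel_left, norm_smul, Real.norm_of_nonneg (hw0 n).le]
      calc w n * ‖x - x₀‖ ≤ w n * r := mul_le_mul_of_nonneg_left hx (hw0 n).le
        _ < 1 * r := mul_lt_mul_of_pos_right (hw1 n) hr
        _ = r := one_mul _
  have hzsK : ∀ n, zs n ∈ K := fun n => hOK (hzsO n)
  have hzlim : Tendsto zs atTop (𝓝 ((t, x) : ℝ × EuclideanSpace ℝ (Fin 3))) := by
    refine Tendsto.prodMk_nhds ?_ ?_
    · have h := ((hwlim.const_sub 1).mul_const (T / 2)).add (hwlim.mul_const t)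
      simpa using h
    · have h := (hwlim.smul_const (x - x₀)).const_add x₀
      simpa using h
  have hzmem : ((t, x) : ℝ × EuclideanSpace ℝ (Fin 3)) ∈ K := ⟨⟨ht.1, ht.2⟩, by rwa [mem_closedBall, dist_eq_norm]⟩
  have hfl : Tendsto (fun n => f (zs n)) atTop (𝓝 (f (t, x))) :=
    (hfc (t, x) hzmem).tendsto.comp (tendsto_nhdsWithin_iff.2 ⟨hzlim, Eventually.of_forall hzsK⟩)
  have hgl : Tendsto (fun n => g (zs n)) atTop (𝓝 (g (t, x))) :=
    (hgc (t, x) hzmem).tendsto.comp (tendsto_nhdsWithin_iff.2 ⟨hzlim, Eventually.of_forall hzsK⟩)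
  have heq : (fun n => f (zs n)) = fun n => g (zs n) := funext fun n => hO_eq (hzsO n)
  rw [heq] at hfl
  exact tendsto_nhds_unique hfl hgl

/-! ### The extension to the final time -/

set_option maxHeartbeats 3200000 in
/-- **Extension of uniformly Hölderian representatives to the final time.** Let `0 < T₀`, `0 < γ`,
and suppose that for every `0 < T_b < T₀` there is `U_{T_b} : ℝ → ℝ³ → ℝ³` with `U_{T_b} = u` a.e. on
`(0,T_b) × B(x₀,1/4)`, `U_{T_b}(0,·) = u₀` on `B̄(x₀,1/4)`, `|U_{T_b}| ≤ C_U` and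
`U_{T_b}` `(C_U, γ)`-parabolic-Hölderian on `[0,T_b] × B̄(x₀,1/4)`. Then there is `U` with the same
four properties on `[0,T₀] × B̄(x₀,1/4)`. [folklore] -/
theorem exists_holder_rep_of_forall_lt {T₀ CU γ : ℝ} (hT₀ : 0 < T₀) (hγ : 0 < γ)
    {x₀ : EuclideanSpace ℝ (Fin 3)} {u₀ : (EuclideanSpace ℝ (Fin 3)) → (EuclideanSpace ℝ (Fin 3))}
    {u : ℝ → (EuclideanSpace ℝ (Fin 3)) → (EuclideanSpace ℝ (Fin 3))}
    (h : ∀ Tb : ℝ, 0 < Tb → Tb < T₀ → ∃ U : ℝ → (EuclideanSpace ℝ (Fin 3)) → (EuclideanSpace ℝ (Fin 3)),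
      uncurry U =ᵐ[volume.restrict (Ioo 0 Tb ×ˢ ball x₀ (1 / 4))] uncurry u ∧
      (∀ x ∈ closedBall x₀ (1 / 4), U 0 x = u₀ x) ∧
      (∀ z ∈ Icc 0 Tb ×ˢ closedBall x₀ (1 / 4), ‖uncurry U z‖ ≤ CU) ∧
      IsParabolicHolderOn (Icc 0 Tb ×ˢ closedBall x₀ (1 / 4)) (uncurry U) CU γ) :
    ∃ U : ℝ → (EuclideanSpace ℝ (Fin 3)) → (EuclideanSpace ℝ (Fin 3)),
      uncurry U =ᵐ[volume.restrict (Ioo 0 T₀ ×ˢ ball x₀ (1 / 4))] uncurry u ∧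
      (∀ x ∈ closedBall x₀ (1 / 4), U 0 x = u₀ x) ∧
      (∀ z ∈ Icc 0 T₀ ×ˢ closedBall x₀ (1 / 4), ‖uncurry U z‖ ≤ CU) ∧
      IsParabolicHolderOn (Icc 0 T₀ ×ˢ closedBall x₀ (1 / 4)) (uncurry U) CU γ := by
  -- ### the exhaustion `T_n = T₀ (1 - 1/(n+2)) ↑ T₀`
  set Ts : ℕ → ℝ := fun n => T₀ * (1 - 1 / ((n : ℝ) + 2)) with hTs
  have hTs0 : ∀ n, 0 < Ts n := fun n => by
    simp only [hTs]
    have : (1 : ℝ) / ((n : ℝ) + 2) < 1 := by rw [div_lt_one (by positivity)]; linarith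
    exact mul_pos hT₀ (by linarith)
  have hTsT : ∀ n, Ts n < T₀ := fun n => by
    simp only [hTs]
    have : (0 : ℝ) < 1 / ((n : ℝ) + 2) := by positivity
    nlinarith
  have hTmono : ∀ {m n : ℕ}, m ≤ n → Ts m ≤ Ts n := fun {m n} hmn => by
    simp only [hTs]
    have h1 : (1 : ℝ) / ((n : ℝ) + 2) ≤ 1 / ((m : ℝ) + 2) :=
      div_le_div_of_nonneg_left zero_le_one (by positivity) (by exact_mod_cast Nat.add_le_add_right hmn 2)
    nlinarith
  have hTlim : Tendsto Ts atTop (𝓝 T₀) := by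
    have h : Tendsto (fun n : ℕ => (1 : ℝ) / ((n : ℝ) + 2)) atTop (𝓝 0) := tendsto_one_div_add_atTop_nhds_zero_nat.comp
      (tendsto_add_atTop_nat 1) |>.congr (fun n => by simp only [Function.comp, Nat.cast_add, Nat.cast_one]; ring_nf)
    have := (h.const_sub 1).const_mul T₀
    simpa only [sub_zero, mul_one] using this
  -- every `t < T₀` is below some `T_n`
  have hexh : ∀ t, t < T₀ → ∃ n, t ≤ Ts n := fun t ht => by
    have h := hTlim.eventually (Ioi_mem_nhds ht)
    obtain ⟨n, hn⟩ := h.exists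
    exact ⟨n, hn.le⟩
  -- ### the representatives on the boxes
  choose V hVae hV0 hVb hVH using fun n => h (Ts n) (hTs0 n) (hTsT n)
  set W : ℕ → ℝ × (EuclideanSpace ℝ (Fin 3)) → (EuclideanSpace ℝ (Fin 3)) := fun n => uncurry (V n) with hW
  set Kn : ℕ → Set (ℝ × EuclideanSpace ℝ (Fin 3)) := fun n => Icc 0 (Ts n) ×ˢ closedBall x₀ (1 / 4) with hKn
  have hKmono : ∀ {m n : ℕ}, m ≤ n → Kn m ⊆ Kn n := fun hmn =>
    Set.prod_mono (Icc_subset_Icc le_rfl (hTmono hmn)) Subset.rfl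
  -- consistency on the common boxes
  have cons : ∀ {m n : ℕ}, m ≤ n → EqOn (W m) (W n) (Kn m) := by
    intro m n hmn
    have hfm : IsParabolicHolderOn (Kn m) (W m) CU γ := hVH m
    have hfn : IsParabolicHolderOn (Kn m) (W n) CU γ := (hVH n).mono (hKmono hmn)
    have hae : W m =ᵐ[volume.restrict (Ioo 0 (Ts m) ×ˢ ball x₀ (1 / 4))] W n := by
      have h1 := hVae m
      have h2 := ae_restrict_of_ae_restrict_of_subset
        (Set.prod_mono (Ioo_subset_Ioo_right (hTmono hmn)) Subset.rfl) (hVae n)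
      exact h1.trans (Filter.EventuallyEq.symm h2)
    exact eqOn_box_of_ae_eq_of_holder (hTs0 m) (by norm_num) hγ hfm hfn hae
  -- ### the approximating sequences and their convergence
  set seq : ℝ × (EuclideanSpace ℝ (Fin 3)) → ℕ → (EuclideanSpace ℝ (Fin 3)) := fun z n => W n (min z.1 (Ts n), z.2) with hseq
  set K : Set (ℝ × EuclideanSpace ℝ (Fin 3)) := Icc 0 T₀ ×ˢ closedBall x₀ (1 / 4) with hK
  have hminmem : ∀ z ∈ K, ∀ n, ((min z.1 (Ts n), z.2) : ℝ × EuclideanSpace ℝ (Fin 3)) ∈ Kn n := fun z hz n =>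
    ⟨⟨le_min hz.1.1 (hTs0 n).le, min_le_right _ _⟩, hz.2⟩
  have hCU : 0 ≤ CU := (norm_nonneg _).trans
    (hVb 0 ((0 : ℝ), x₀) ⟨⟨le_rfl, (hTs0 0).le⟩, mem_closedBall_self (by norm_num)⟩)
  -- increments of the sequence are controlled by the uniform Hölder bound in time
  have hincr : ∀ z ∈ K, ∀ {m n : ℕ}, m ≤ n →
      ‖seq z n - seq z m‖ ≤ CU * (|Ts n - Ts m| ^ (1 / 2 : ℝ)) ^ γ := by
    intro z hz m n hmn
    have e1 : seq z m = W n (min z.1 (Ts m), z.2) := by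
      simp only [hseq]; exact cons hmn (hminmem z hz m)
    rw [e1]
    simp only [hseq]
    have hmem1 : ((min z.1 (Ts n), z.2) : ℝ × EuclideanSpace ℝ (Fin 3)) ∈ Kn n := hminmem z hz n
    have hmem2 : ((min z.1 (Ts m), z.2) : ℝ × EuclideanSpace ℝ (Fin 3)) ∈ Kn n := hKmono hmn (hminmem z hz m)
    have h1 := hVH n _ hmem1 _ hmem2
    refine h1.trans (mul_le_mul_of_nonneg_left ?_ ?_)
    · simp only [sub_self, norm_zero, add_zero]
      refine Real.rpow_le_rpow (Real.rpow_nonneg (abs_nonneg _) _) ?_ hγ.le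
      refine Real.rpow_le_rpow (abs_nonneg _) ?_ (by norm_num)
      have := abs_min_sub_min_le_max z.1 (Ts n) z.1 (Ts m)
      simp only [sub_self, abs_zero] at this
      exact this.trans (max_le (abs_nonneg _) le_rfl)
    · exact hCU
  -- the increments tend to zero, uniformly on `K`
  set bnd : ℕ → ℝ := fun N => CU * ((T₀ - Ts N) ^ (1 / 2 : ℝ)) ^ γ with hbnd
  have hbnd : Tendsto bnd atTop (𝓝 0) := by
    have h1 : Tendsto (fun N => T₀ - Ts N) atTop (𝓝 0) := by
      have := hTlim.const_sub T₀; simpa only [sub_self] using this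
    have h2 : Tendsto (fun N => (T₀ - Ts N) ^ (1 / 2 : ℝ)) atTop (𝓝 0) := by
      have := h1.rpow_const (p := (1 / 2 : ℝ)) (Or.inr (by norm_num))
      simpa only [Real.zero_rpow (by norm_num : (1 / 2 : ℝ) ≠ 0)] using this
    have h3 : Tendsto (fun N => ((T₀ - Ts N) ^ (1 / 2 : ℝ)) ^ γ) atTop (𝓝 0) := by
      have := h2.rpow_const (p := γ) (Or.inr hγ.le)
      simpa only [Real.zero_rpow hγ.ne'] using this
    have := h3.const_mul CU
    simpa only [mul_zero] using this
  have hincr' : ∀ z ∈ K, ∀ {m n : ℕ}, m ≤ n → ‖seq z n - seq z m‖ ≤ bnd m := by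
    intro z hz m n hmn
    refine (hincr z hz hmn).trans (mul_le_mul_of_nonneg_left ?_ hCU)
    refine Real.rpow_le_rpow (Real.rpow_nonneg (abs_nonneg _) _) ?_ hγ.le
    refine Real.rpow_le_rpow (abs_nonneg _) ?_ (by norm_num)
    rw [abs_of_nonneg (by linarith [hTmono hmn])]
    linarith [hTsT n]
  have hcauchy : ∀ z ∈ K, CauchySeq (seq z) := by
    intro z hz
    rw [Metric.cauchySeq_iff']
    intro ε hε
    obtain ⟨N, hN⟩ := (hbnd.eventually (gt_mem_nhds hε)).exists
    refine ⟨N, fun n hn => ?_⟩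
    rw [dist_eq_norm]
    exact (hincr' z hz hn).trans_lt hN
  -- ### the limit representative
  set U : ℝ → (EuclideanSpace ℝ (Fin 3)) → (EuclideanSpace ℝ (Fin 3)) := fun t x => limUnder atTop (seq (t, x)) with hU
  have hUlim : ∀ z ∈ K, Tendsto (seq z) atTop (𝓝 (uncurry U z)) := by
    rintro ⟨t, x⟩ hz
    exact (hcauchy _ hz).tendsto_limUnder
  have hUeq : ∀ z ∈ K, ∀ m, z.1 ≤ Ts m → uncurry U z = W m z := by
    intro z hz m hm
    have hev : ∀ n, m ≤ n → seq z n = W m z := fun n hn => by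
      have e1 : min z.1 (Ts n) = z.1 := min_eq_left (hm.trans (hTmono hn))
      simp only [hseq, e1, Prod.mk.eta]
      exact (cons hn ⟨⟨hz.1.1, hm⟩, hz.2⟩).symm
    have hconst : Tendsto (seq z) atTop (𝓝 (W m z)) :=
      tendsto_const_nhds.congr' (eventually_atTop.2 ⟨m, fun n hn => (hev n hn).symm⟩)
    exact tendsto_nhds_unique (hUlim z hz) hconst
  have hKn_sub : ∀ n, Kn n ⊆ K := fun n => Set.prod_mono (Icc_subset_Icc le_rfl (hTsT n).le) Subset.rfl
  refine ⟨U, ?_, ?_, ?_, ?_⟩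
  · -- a.e. equality with `u`
    have hcover : Ioo 0 T₀ ×ˢ ball x₀ (1 / 4) ⊆ ⋃ m, Ioo 0 (Ts m) ×ˢ ball x₀ (1 / 4) := by
      rintro ⟨t, x⟩ ⟨ht, hx⟩
      obtain ⟨m, hm⟩ := hexh ((t + T₀) / 2) (by linarith [ht.2])
      exact mem_iUnion.2 ⟨m, ⟨ht.1, by linarith [ht.2]⟩, hx⟩
    refine ae_restrict_of_ae_restrict_of_subset hcover ?_
    rw [ae_restrict_iUnion_iff]
    intro m
    filter_upwards [hVae m, ae_restrict_mem (measurableSet_Ioo.prod measurableSet_ball)] with z hz hzm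
    have hzK : z ∈ K := ⟨⟨hzm.1.1.le, (hzm.1.2.trans (hTsT m)).le⟩, ball_subset_closedBall hzm.2⟩
    rw [hUeq z hzK m hzm.1.2.le]
    exact hz
  · -- the initial value
    intro x hx
    have hzK : ((0 : ℝ), x) ∈ K := ⟨⟨le_rfl, hT₀.le⟩, hx⟩
    have h := hUeq ((0 : ℝ), x) hzK 0 (hTs0 0).le
    simp only [uncurry, hW] at h
    rw [show U 0 x = uncurry U ((0 : ℝ), x) from rfl, hUeq ((0 : ℝ), x) hzK 0 (hTs0 0).le]
    exact hV0 0 x hx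
  · -- the bound
    intro z hz
    refine le_of_tendsto (hUlim z hz).norm (Eventually.of_forall fun n => ?_)
    exact hVb n _ (hminmem z hz n)
  · -- the Hölder bound
    intro z₁ h₁ z₂ h₂
    have hlim := ((hUlim z₁ h₁).sub (hUlim z₂ h₂)).norm
    refine le_of_tendsto hlim (Eventually.of_forall fun n => ?_)
    have h := hVH n _ (hminmem z₁ h₁ n) _ (hminmem z₂ h₂ n)
    refine h.trans (mul_le_mul_of_nonneg_left ?_ hCU)
    have hsum0 : 0 ≤ |min z₁.1 (Ts n) - min z₂.1 (Ts n)| ^ (1 / 2 : ℝ) + ‖z₁.2 - z₂.2‖ := by positivity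
    refine Real.rpow_le_rpow hsum0 (add_le_add ?_ le_rfl) hγ.le
    refine Real.rpow_le_rpow (abs_nonneg _) ?_ (by norm_num)
    have := abs_min_sub_min_le_max z₁.1 (Ts n) z₂.1 (Ts n)
    simp only [sub_self, abs_zero] at this
    exact this.trans (max_le le_rfl (abs_nonneg _))

end JiaSverak2014

end Literature.Analysis.FluidPDE

end
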